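import Summits.AtomisticToContinuum.Crystallization.Theorems.ExcessDecayLiouvillePhononStabilityCertCharge

/-!
# Near-certificate layer XII-d: far chain charges with SCALED rounding and GENERAL steps (lead c2, vertex scheme)

Support file for crux `PhononStability` (stmt-AtomisticToContinuum-9333), line `contragredient-window-collapse`.

Two repairs of the chain-charge bookkeeping of layer XII (`CertCharge`):
* `uOfQ` rounds the far coefficient `U(Q) ≥ |ω|` up to six decimals, which swamps the true value beyond
  `‖ζ⁰‖ ≈ 6` (`|ω| ~ 16‖ζ⁰‖⁻¹⁰`); `uOfQD D` rounds up to denominator `D` (any `D ≥ 1`), `abs_omegaLJ_le_uOfQD`.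
* chains with steps of ANY reference length (the accumulated far charge lands on all step classes of the radius-√2
  difference star, not only on nearest-neighbour classes): the fixed weights `‖ζ⁰_s‖` of `chainCharge` are sandwiched by
  the rationals `lloQ ≤ ‖ζ⁰_s‖ ≤ lupQ` of the chart layer, so that the charge of a class along a chain is dominated by a
  RATIONAL multiple of a sum of directional pair forms (`charge_step_bound`), and the directional form is the pair form of
  the outer product of `ẑ_c(δ̂)` (`dirForm_eq_pairEvalR_zhat`).
-/

noncomputable section

open scoped BigOperators Classical InnerProductSpace
open Filter Set Function
open Summit.AtomisticToContinuum.Crystallization.Theorems.PhononStabilityNegative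
open Summit.AtomisticToContinuum.Crystallization.Theorems.PhononStabilityCWC.FarControlStub

namespace Summit.AtomisticToContinuum.Crystallization.Theorems.PhononStabilityCWC.Cert

local notation "E3" => EuclideanSpace ℝ (Fin 3)

/-! ## The scaled far coefficient -/

/-- the rational far charge `U_D(Q) = ⌈(1611/100)(36/Q)⁵·D⌉/D` (rounded up to denominator `D`). -/
def uOfQD (D : ℕ) (Q : ℤ) : ℚ := (⌈(1611 / 100 : ℚ) * (36 / (Q : ℚ)) ^ 5 * D⌉ : ℚ) / D

/-- `U_D(Q)` dominates the exact bound. [folklore] -/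
theorem le_uOfQD {D : ℕ} (hD : 0 < D) (Q : ℤ) : (1611 / 100 : ℝ) * ((36 : ℝ) / (Q : ℝ)) ^ 5 ≤ (uOfQD D Q : ℝ) := by
  unfold uOfQD
  have h := Int.le_ceil ((1611 / 100 : ℚ) * (36 / (Q : ℚ)) ^ 5 * D)
  have h' : (((1611 / 100 : ℚ) * (36 / (Q : ℚ)) ^ 5 * D : ℚ) : ℝ) ≤
      ((⌈(1611 / 100 : ℚ) * (36 / (Q : ℚ)) ^ 5 * D⌉ : ℚ) : ℝ) := by exact_mod_cast h
  have hDr : (0 : ℝ) < D := by exact_mod_cast hD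
  push_cast at h' ⊢
  rw [le_div_iff₀ hDr]
  linarith

/-- **the far charge of a class:** `|ω(‖Aζ_c(δ)‖)| ≤ U_D(Q(c))` on the window for `Q(c) ≥ 144`. [folklore] -/
theorem abs_omegaLJ_le_uOfQD {D : ℕ} (hD : 0 < D) {A : E3 →L[ℝ] E3} {δ : E3} (hW : CellWindow A) (hδ : ShiftWindow A δ)
    {c : BondClass} (hc : 144 ≤ Qint c) : |omegaLJ ‖A (bondVec δ c)‖| ≤ (uOfQD D (Qint c) : ℝ) :=
  (abs_omegaLJ_far hW hδ hc).trans (le_uOfQD hD (Qint c))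

/-! ## Rational weights of a general chain -/

/-- `lloQ Q > 0` for `Q ≥ 36`. [folklore] -/
theorem lloQ_pos {Q : ℤ} (hQ : 36 ≤ Q) : 0 < lloQ Q := by
  unfold lloQ
  have h1 : (36000000 : ℕ) ≤ Q.toNat * 1000000 := by
    have : (36 : ℕ) ≤ Q.toNat := by omega
    nlinarith
  have h2 : Nat.sqrt 36000000 ≤ Nat.sqrt (Q.toNat * 1000000) := Nat.sqrt_le_sqrt h1
  have h3 : Nat.sqrt 36000000 = 6000 := by norm_num [Nat.sqrt_eq']
  have h4 : (6000 : ℕ) ≤ Nat.sqrt (Q.toNat * 1000000) := h3 ▸ h2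
  have h5 : (6000 : ℚ) ≤ (Nat.sqrt (Q.toNat * 1000000) : ℚ) := by exact_mod_cast h4
  positivity

/-- the sum of the upper length bounds along a chain -/
def chainUp (ch : List BondClass) : ℚ := (ch.map fun s => lupQ (Qint s)).sum

/-- `chainConst ch ≤ Σ_s lupQ(Q_s)`. [folklore] -/
theorem chainConst_le_chainUp (ch : List BondClass) : chainConst ch ≤ (chainUp ch : ℝ) := by
  unfold chainConst chainUp
  push_cast
  induction ch with
  | nil => simp
  | cons s rest ih =>
      simp only [List.map_cons, List.sum_cons]
      exact add_le_add (llo_le_norm_le_lup s).2 ih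

/-- the rationally weighted sum of directional forms along a chain -/
def chainDirQ (v : E3) (ch : List BondClass) (w : Label → E3) : ℝ :=
  (ch.map fun s => ((lloQ (Qint s))⁻¹ : ℝ) * dirForm v s w).sum

/-- `dirForm ≥ 0`. [folklore] -/
theorem dirForm_nonneg (v : E3) (s : BondClass) (w : Label → E3) : 0 ≤ dirForm v s w :=
  tsum_nonneg fun _ => sq_nonneg _

/-- `Σ_s ‖ζ⁰_s‖⁻¹ dirForm ≤ Σ_s lloQ(Q_s)⁻¹ dirForm` for a chain of steps with `Q ≥ 36`. [folklore] -/
theorem chain_sum_le_chainDirQ (v : E3) (w : Label → E3) {ch : List BondClass} (h : ∀ s ∈ ch, 36 ≤ Qint s) :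
    (ch.map fun s => ‖bondVec 0 s‖⁻¹ * dirForm v s w).sum ≤ chainDirQ v ch w := by
  unfold chainDirQ
  refine List.sum_le_sum fun s hs => ?_
  have hl := lloQ_pos (h s hs)
  have hl' : (0 : ℝ) < lloQ (Qint s) := by exact_mod_cast hl
  have hle := (llo_le_norm_le_lup s).1
  exact mul_le_mul_of_nonneg_right ((inv_le_inv₀ (lt_of_lt_of_le hl' hle) hl').mpr hle) (dirForm_nonneg v s w)

/-- `chainDirQ ≥ 0`. [folklore] -/
theorem chainDirQ_nonneg (v : E3) (w : Label → E3) {ch : List BondClass} (h : ∀ s ∈ ch, 36 ≤ Qint s) :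
    0 ≤ chainDirQ v ch w := by
  unfold chainDirQ
  refine List.sum_nonneg ?_
  intro x hx
  rw [List.mem_map] at hx
  obtain ⟨s, hs, rfl⟩ := hx
  have hl : (0 : ℝ) < lloQ (Qint s) := by exact_mod_cast lloQ_pos (h s hs)
  exact mul_nonneg (inv_nonneg.mpr hl.le) (dirForm_nonneg v s w)

/-- **THE CHARGE OF A CLASS ALONG A GENERAL CHAIN** is dominated by a rational multiple of the rationally weighted
directional forms: `|ω|·chainCharge ≤ U_D(Q) · chainUp · chainDirQ`. [folklore] -/
theorem charge_step_bound {D : ℕ} (hD : 0 < D) {A : E3 →L[ℝ] E3} {δ : E3} (hW : CellWindow A) (hδ : ShiftWindow A δ)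
    {c : BondClass} (hc : 144 ≤ Qint c) {ch : List BondClass} (h : ∀ s ∈ ch, 36 ≤ Qint s) (w : Label → E3) :
    |omegaLJ ‖A (bondVec δ c)‖| * chainCharge δ c ch w ≤
      (uOfQD D (Qint c) : ℝ) * (chainUp ch : ℝ) * chainDirQ (bondVec δ c) ch w := by
  unfold chainCharge
  have hU := abs_omegaLJ_le_uOfQD hD hW hδ hc
  have hC := chainConst_le_chainUp ch
  have hS := chain_sum_le_chainDirQ (bondVec δ c) w h
  have hC0 : 0 ≤ chainConst ch := by
    unfold chainConst
    exact List.sum_nonneg (by intro x hx; rw [List.mem_map] at hx; obtain ⟨s, -, rfl⟩ := hx; exact norm_nonneg _)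
  have hS0 : 0 ≤ (ch.map fun s => ‖bondVec 0 s‖⁻¹ * dirForm (bondVec δ c) s w).sum :=
    List.sum_nonneg (by
      intro x hx; rw [List.mem_map] at hx; obtain ⟨s, -, rfl⟩ := hx
      exact mul_nonneg (inv_nonneg.mpr (norm_nonneg _)) (dirForm_nonneg _ s w))
  have hω0 : 0 ≤ |omegaLJ ‖A (bondVec δ c)‖| := abs_nonneg _
  have hU0 : 0 ≤ (uOfQD D (Qint c) : ℝ) := hω0.trans hU
  have hCu0 : 0 ≤ (chainUp ch : ℝ) := hC0.trans hC
  calc |omegaLJ ‖A (bondVec δ c)‖| * (chainConst ch * (ch.map fun s => ‖bondVec 0 s‖⁻¹ * dirForm (bondVec δ c) s w).sum)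
      ≤ (uOfQD D (Qint c) : ℝ) * (chainConst ch * (ch.map fun s => ‖bondVec 0 s‖⁻¹ * dirForm (bondVec δ c) s w).sum) :=
        mul_le_mul_of_nonneg_right hU (mul_nonneg hC0 hS0)
    _ ≤ (uOfQD D (Qint c) : ℝ) * ((chainUp ch : ℝ) * chainDirQ (bondVec δ c) ch w) := by
        refine mul_le_mul_of_nonneg_left ?_ hU0
        exact mul_le_mul hC hS hS0 hCu0
    _ = (uOfQD D (Qint c) : ℝ) * (chainUp ch : ℝ) * chainDirQ (bondVec δ c) ch w := by ring

/-! ## The directional form as a pair form of the contravariant bond coordinates -/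

/-- `dirForm (ζ_c(δ)) s w = pairEvalR s (ẑ_c(δ̂) ẑ_c(δ̂)ᵀ) w`. [folklore] -/
theorem dirForm_eq_pairEvalR_zhat (δ : E3) (c s : BondClass) (w : Label → E3) :
    dirForm (bondVec δ c) s w = pairEvalR s (fun i j => zhat c (contraOf δ) i * zhat c (contraOf δ) j) w := by
  have h := chartIdentities.2.2.1 (bondVec δ c) s w
  rw [chartIdentities.2.1 δ c] at h
  exact h

/-- Anchor of this support file (registered stub of the line skeleton, lead c2): the scaled coefficient at `D = 1`. -/
theorem stub_certChargeD : uOfQD 1 36 = 17 := by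
  unfold uOfQD; norm_num

end Summit.AtomisticToContinuum.Crystallization.Theorems.PhononStabilityCWC.Cert

end
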